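import Mathlib.Topology.Sets.Opens
import Mathlib.Topology.Sober
import Mathlib.Topology.Connected.LocallyConnected
import Mathlib.Topology.Homeomorph.Lemmas
import Mathlib.CategoryTheory.Category.Preorder
import Mathlib.CategoryTheory.Limits.FormalCoproducts.Basic
import Mathlib.CategoryTheory.ObjectProperty.FullSubcategory
import Literature.AlgebraicGeometry.Frobenioids.TopologicalRepresentation
import Literature.AlgebraicGeometry.Frobenioids.TopologicalRepresentationProofs
import HarnessLib

/-!
# Frobenioids II, Appendix: Theorem A.2 (iv) and (vi) — sober spaces from their categories of opens

Mochizuki, *The geometry of Frobenioids II*, Kyushu J. Math. **62** (2008), Appendix "Categorical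
Representation of Topological Spaces", author's text pp. 67–68 [cite: MochizukiFrdII2008, Thm A.2
pp.67-68]. This file DISCHARGES the named facts `TopRep.ItemIV` and `TopRep.ItemVI` of
`TopologicalRepresentation.lean` (signatures untouched):

* `ItemIV_holds` — for sober `X`, `Y`, every equivalence `Open(X) ≃ Open(Y)` agrees on objects with the
  equivalence induced by a unique homeomorphism `X ≃ Y`. The printed proof goes through [John] Thm 7.24
  (points of the topos `Shv(X)`); we give the direct frame-theoretic argument: an equivalence of the partial
  orders `Open(−)` is an order isomorphism; the complement of the closure of a point is a *prime* open
  (`W ≠ X` and `V₁ ∩ V₂ ⊆ W ⇒ V₁ ⊆ W or V₂ ⊆ W`, an order-theoretic condition, i.e. the complement is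
  irreducible); order isomorphisms carry prime opens to prime opens, and soberness turns the image back
  into a unique point. Uniqueness uses only `T₀`.
* `ItemVI_holds` — for sober, locally connected `X`, `Y`, the same for equivalences `Open⁰(X) ≃ Open⁰(Y)`:
  such an equivalence is a monotone bijection on connected opens preserving disjointness (which is
  order-theoretic in `Open⁰`, Remark A.1.1), hence extends — via the decomposition of an open into its
  connected components (Theorem A.2 (v), file `TopologicalRepresentationProofs`) — to an order isomorphism
  of `Open(−)`, to which (iv) applies ("(vi) follows immediately from (iv), (v)", p. 68).

All statements are theorems (no new definitions); inputs are Mathlib topology only.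
-/

namespace Literature.AlgebraicGeometry.Frobenioids

open CategoryTheory Topology TopologicalSpace Set Function

universe u

namespace TopRep

variable {X Y : Type u} [TopologicalSpace X] [TopologicalSpace Y]

/-! ### Prime opens and points of sober spaces -/

/-- A point `x` lies in an open `V` iff `V` is not contained in the complement of the closure of `x`.
[cite: MochizukiFrdII2008, Thm A.2 (iv) pp.67-68] -/
theorem mem_opens_iff_not_subset_compl_closure (V : Opens X) (x : X) :
    x ∈ V ↔ ¬ ((V : Set X) ⊆ (closure {x})ᶜ) := by
  constructor
  · intro hx h
    exact h hx (subset_closure (mem_singleton x))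
  · intro h
    obtain ⟨z, hzV, hz⟩ := not_subset.mp h
    rw [mem_compl_iff, not_not] at hz
    obtain ⟨w, hwV, hw⟩ := mem_closure_iff.mp hz V V.isOpen hzV
    rw [mem_singleton_iff] at hw
    exact hw ▸ hwV

/-- An open `W ⊆ X` has irreducible (closed) complement iff it is *prime* in the lattice `Open(X)`:
`W ≠ X` and `V₁ ∩ V₂ ⊆ W` forces `V₁ ⊆ W` or `V₂ ⊆ W` — a purely order-theoretic condition.
[cite: MochizukiFrdII2008, Thm A.2 (iv) pp.67-68] -/
theorem isIrreducible_compl_iff (W : Opens X) :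
    IsIrreducible ((W : Set X)ᶜ) ↔
      W ≠ ⊤ ∧ ∀ V₁ V₂ : Opens X, V₁ ⊓ V₂ ≤ W → V₁ ≤ W ∨ V₂ ≤ W := by
  rw [IsIrreducible, nonempty_compl, ne_eq, Opens.coe_eq_univ]
  refine and_congr Iff.rfl ⟨fun h V₁ V₂ h12 => ?_, fun h u v hu hv hu' hv' => ?_⟩
  · by_contra hcon
    rw [not_or] at hcon
    obtain ⟨h1, h2⟩ := hcon
    have h1' : ((W : Set X)ᶜ ∩ V₁).Nonempty := by
      rw [inter_comm, inter_compl_nonempty_iff]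
      exact h1
    have h2' : ((W : Set X)ᶜ ∩ V₂).Nonempty := by
      rw [inter_comm, inter_compl_nonempty_iff]
      exact h2
    obtain ⟨z, hzW, hz12⟩ := h V₁ V₂ V₁.isOpen V₂.isOpen h1' h2'
    exact hzW (h12 (show z ∈ V₁ ⊓ V₂ from hz12))
  · rw [inter_comm, inter_compl_nonempty_iff] at hu' hv' ⊢
    intro huv
    rcases h ⟨u, hu⟩ ⟨v, hv⟩ (fun z hz => huv hz) with h' | h'
    · exact hu' h'
    · exact hv' h'

/-- An order isomorphism `Open(X) ≃ Open(Y)` carries prime opens to prime opens (it preserves `⊤` and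
`⊓`). [cite: MochizukiFrdII2008, Thm A.2 (iv) pp.67-68] -/
theorem prime_map (f : Opens X ≃o Opens Y) {W : Opens X}
    (hW : W ≠ ⊤ ∧ ∀ V₁ V₂ : Opens X, V₁ ⊓ V₂ ≤ W → V₁ ≤ W ∨ V₂ ≤ W) :
    f W ≠ ⊤ ∧ ∀ V₁ V₂ : Opens Y, V₁ ⊓ V₂ ≤ f W → V₁ ≤ f W ∨ V₂ ≤ f W := by
  refine ⟨fun h => hW.1 (f.injective (h.trans f.map_top.symm)), fun V₁ V₂ h => ?_⟩
  have h' : f.symm V₁ ⊓ f.symm V₂ ≤ W := by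
    rw [← f.symm.map_inf, ← f.symm_apply_apply W]
    exact f.symm.monotone h
  rcases hW.2 _ _ h' with h1 | h2
  · exact Or.inl (by simpa using f.monotone h1)
  · exact Or.inr (by simpa using f.monotone h2)

/-- The point of a sober space `Y` attached to a point `x ∈ X` by an order isomorphism
`f : Open(X) ≃ Open(Y)`: the generic point `y` of the (irreducible, closed) complement of the prime open
`f((closure {x})ᶜ)`; it is characterised by `y ∈ V ⇔ x ∈ f⁻¹(V)` for all opens `V ⊆ Y`.
[cite: MochizukiFrdII2008, Thm A.2 (iv) pp.67-68] -/
theorem exists_point_of_orderIso (hY : IsSober Y) (f : Opens X ≃o Opens Y) (x : X) :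
    ∃ y : Y, ∀ V : Opens Y, y ∈ V ↔ x ∈ f.symm V := by
  let W : Opens X := ⟨(closure {x})ᶜ, isClosed_closure.isOpen_compl⟩
  have hWc : ((W : Set X)ᶜ) = closure {x} := compl_compl _
  have hW := (isIrreducible_compl_iff W).mp (by rw [hWc]; exact isIrreducible_singleton.closure)
  have hfW := (isIrreducible_compl_iff (f W)).mpr (prime_map f hW)
  obtain ⟨y, ⟨-, hy⟩, -⟩ := hY.existsUnique_generic _ hfW (f W).isOpen.isClosed_compl
  refine ⟨y, fun V => ?_⟩
  rw [mem_opens_iff_not_subset_compl_closure, mem_opens_iff_not_subset_compl_closure, ← hy,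
    compl_compl, ← hWc, compl_compl, SetLike.coe_subset_coe, SetLike.coe_subset_coe, not_iff_not]
  constructor
  · intro h
    simpa using f.symm.monotone h
  · intro h
    simpa using f.monotone h

/-- Membership in `h.opensCongr U` (the image of `U` under the homeomorphism `h`).
[cite: MochizukiFrdII2008, Thm A.2 (iv) p.67] -/
theorem mem_opensCongr_iff (h : X ≃ₜ Y) (U : Opens X) (y : Y) :
    y ∈ h.opensCongr U ↔ h.symm y ∈ U := Iff.rfl

/-- **The order-theoretic core of Theorem A.2 (iv)**: for sober `X`, `Y`, every order isomorphism
`f : Open(X) ≃ Open(Y)` is induced (`U ↦ h(U)`) by a unique homeomorphism `h : X ≃ Y`. Existence: glue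
the points of `exists_point_of_orderIso` for `f` and `f⁻¹` (mutually inverse and continuous since
`h⁻¹(V) = f⁻¹(V)`); uniqueness: in a `T₀` space a point is determined by its open neighbourhoods.
[cite: MochizukiFrdII2008, Thm A.2 (iv) pp.67-68] -/
theorem existsUnique_homeomorph_of_orderIso (hX : IsSober X) (hY : IsSober Y)
    (f : Opens X ≃o Opens Y) : ∃! h : X ≃ₜ Y, ∀ U : Opens X, f U = h.opensCongr U := by
  have hT0X : T0Space X := ((isSober_iff_quasiSober X).mp hX).2
  have hT0Y : T0Space Y := ((isSober_iff_quasiSober Y).mp hY).2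
  choose h hh using exists_point_of_orderIso hY f
  choose g hg using exists_point_of_orderIso hX f.symm
  simp only [OrderIso.symm_symm] at hg
  have hgh : ∀ x, g (h x) = x := fun x =>
    Inseparable.eq ((inseparable_iff_forall_isOpen).mpr fun s hs => by
      rw [show (g (h x) ∈ s ↔ h x ∈ f ⟨s, hs⟩) from hg (h x) ⟨s, hs⟩, hh x, f.symm_apply_apply]
      rfl)
  have hhg : ∀ y, h (g y) = y := fun y =>
    Inseparable.eq ((inseparable_iff_forall_isOpen).mpr fun s hs => by
      rw [show (h (g y) ∈ s ↔ g y ∈ f.symm ⟨s, hs⟩) from hh (g y) ⟨s, hs⟩, hg y,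
        f.apply_symm_apply]
      rfl)
  have hcont : Continuous h := continuous_def.mpr fun s hs => by
    have : h ⁻¹' s = ((f.symm ⟨s, hs⟩ : Opens X) : Set X) := Set.ext fun x => hh x ⟨s, hs⟩
    rw [this]
    exact (f.symm ⟨s, hs⟩).isOpen
  have gcont : Continuous g := continuous_def.mpr fun s hs => by
    have : g ⁻¹' s = ((f ⟨s, hs⟩ : Opens Y) : Set Y) := Set.ext fun y => hg y ⟨s, hs⟩
    rw [this]
    exact (f ⟨s, hs⟩).isOpen
  let e : X ≃ₜ Y :=
    { toFun := h, invFun := g, left_inv := hgh, right_inv := hhg,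
      continuous_toFun := hcont, continuous_invFun := gcont }
  have he : ∀ U : Opens X, f U = e.opensCongr U := fun U => by
    ext y
    exact (hg y U).symm
  refine ⟨e, he, fun e' he' => ?_⟩
  have hsymm : ∀ y, e'.symm y = e.symm y := fun y =>
    Inseparable.eq ((inseparable_iff_forall_isOpen).mpr fun s hs => by
      show e'.symm y ∈ (⟨s, hs⟩ : Opens X) ↔ e.symm y ∈ (⟨s, hs⟩ : Opens X)
      rw [← mem_opensCongr_iff e' ⟨s, hs⟩ y, ← mem_opensCongr_iff e ⟨s, hs⟩ y, ← he' ⟨s, hs⟩,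
        ← he ⟨s, hs⟩])
  ext x
  calc e' x = e' (e'.symm (e x)) := by rw [hsymm, e.symm_apply_apply]
    _ = e x := e'.apply_symm_apply _

variable (X Y) in
/-- **Theorem A.2 (iv)**, PROVED (FrdII App. p. 67): "Suppose that `X`, `Y` are sober. Then passing to
the induced equivalence on the categories `Open(−)` determines a bijection between the equivalences of
categories `Open(X) ≃ Open(Y)` [considered up to isomorphism] and the homeomorphisms `X ≃ Y`" — in the
typed form: every equivalence agrees on objects with `h.opensCongr` for a unique homeomorphism `h`
(an equivalence of the partial orders `Open(−)` is an order isomorphism, `Equivalence.toOrderIso`).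
[cite: MochizukiFrdII2008, Thm A.2 (iv) p.67] -/
theorem ItemIV_holds : ItemIV X Y := fun hX hY e => by
  obtain ⟨h, hh, huniq⟩ := existsUnique_homeomorph_of_orderIso hX hY e.toOrderIso
  refine ⟨h, fun U => ?_, fun h' hh' => huniq h' fun U => ?_⟩
  · rw [← hh U, Equivalence.toOrderIso_apply]
  · rw [Equivalence.toOrderIso_apply]
    exact hh' U

/-! ### Theorem A.2 (vi): from `Open⁰(−)` to `Open(−)` for locally connected spaces -/

/-- Isomorphic objects of `Open⁰(X)` are equal (the category is a partial order).
[cite: MochizukiFrdII2008, Appendix p.66] -/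
theorem Open0.eq_of_iso {A B : Open0 X} (i : A ≅ B) : A = B :=
  ObjectProperty.FullSubcategory.ext (le_antisymm i.hom.hom.le i.inv.hom.le)

section equivalence

variable (e : Open0 X ≌ Open0 Y)

/-- An equivalence `Open⁰(X) ≃ Open⁰(Y)` is inverted on objects by its quasi-inverse.
[cite: MochizukiFrdII2008, Thm A.2 (vi) p.67] -/
theorem inverse_obj_functor_obj (A : Open0 X) : e.inverse.obj (e.functor.obj A) = A :=
  (Open0.eq_of_iso (e.unitIso.app A)).symm

/-- An equivalence `Open⁰(X) ≃ Open⁰(Y)` inverts its quasi-inverse on objects.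
[cite: MochizukiFrdII2008, Thm A.2 (vi) p.67] -/
theorem functor_obj_inverse_obj (B : Open0 Y) : e.functor.obj (e.inverse.obj B) = B :=
  Open0.eq_of_iso (e.counitIso.app B)

/-- An equivalence `Open⁰(X) ≃ Open⁰(Y)` is monotone on connected opens.
[cite: MochizukiFrdII2008, Thm A.2 (vi) p.67] -/
theorem functor_obj_mono {A A' : Open0 X} (h : A.obj ≤ A'.obj) :
    (e.functor.obj A).obj ≤ (e.functor.obj A').obj :=
  (e.functor.map (ObjectProperty.homMk (homOfLE h))).hom.le

/-- The quasi-inverse of an equivalence `Open⁰(X) ≃ Open⁰(Y)` is monotone on connected opens.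
[cite: MochizukiFrdII2008, Thm A.2 (vi) p.67] -/
theorem inverse_obj_mono {B B' : Open0 Y} (h : B.obj ≤ B'.obj) :
    (e.inverse.obj B).obj ≤ (e.inverse.obj B').obj :=
  (e.inverse.map (ObjectProperty.homMk (homOfLE h))).hom.le

/-- In a locally connected space, disjointness of two connected opens is order-theoretic in `Open⁰(X)`:
no connected open lies below both (cf. Remark A.1.1). [cite: MochizukiFrdII2008, Rmk A.1.1 p.67] -/
theorem disjoint_iff_forall_open0 [LocallyConnectedSpace X] (A A' : Open0 X) :
    Disjoint ((A.obj : Opens X) : Set X) A'.obj ↔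
      ∀ C : Open0 X, C.obj ≤ A.obj → ¬ C.obj ≤ A'.obj := by
  constructor
  · intro h C hC hC'
    obtain ⟨x, hx⟩ := C.property.nonempty
    exact Set.disjoint_iff.mp h ⟨hC hx, hC' hx⟩
  · intro h
    rw [Set.disjoint_iff]
    rintro x ⟨hx, hx'⟩
    have hU : IsOpen (((A.obj : Opens X) : Set X) ∩ A'.obj) := A.obj.isOpen.inter A'.obj.isOpen
    obtain ⟨V, hVU, hVo, hxV, hVc⟩ :=
      locallyConnectedSpace_iff_subsets_isOpen_isConnected.mp inferInstance x _
        (hU.mem_nhds ⟨hx, hx'⟩)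
    exact h ⟨⟨V, hVo⟩, hVc⟩ (fun y hy => (hVU hy).1) (fun y hy => (hVU hy).2)

/-- An equivalence `Open⁰(X) ≃ Open⁰(Y)` of locally connected spaces preserves disjointness of connected
opens ("`Disjt(Open⁰(−))` may be reconstructed directly from the category `Open⁰(−)`", FrdII App. p. 68).
[cite: MochizukiFrdII2008, Thm A.2 (vi) p.68] -/
theorem disjoint_functor_obj [LocallyConnectedSpace X] [LocallyConnectedSpace Y] {A A' : Open0 X}
    (h : Disjoint ((A.obj : Opens X) : Set X) A'.obj) :
    Disjoint (((e.functor.obj A).obj : Opens Y) : Set Y) (e.functor.obj A').obj := by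
  rw [disjoint_iff_forall_open0] at h ⊢
  intro D hD hD'
  refine h (e.inverse.obj D) ?_ ?_
  · simpa only [inverse_obj_functor_obj] using inverse_obj_mono e hD
  · simpa only [inverse_obj_functor_obj] using inverse_obj_mono e hD'

/-- The extension `F(V) = ⋃ {e(C) : C ⊆ V connected open}` of `e` to all opens is monotone. We state
the extension through its membership characterisation `hF` (no auxiliary definition).
[cite: MochizukiFrdII2008, Thm A.2 (vi) p.68] -/
theorem ext_mono {F : Opens X → Opens Y}
    (hF : ∀ (V : Opens X) (y : Y), y ∈ F V ↔ ∃ C : Open0 X, C.obj ≤ V ∧ y ∈ (e.functor.obj C).obj)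
    {V V' : Opens X} (h : V ≤ V') : F V ≤ F V' := fun y hy => by
  obtain ⟨C, hC, hy⟩ := (hF V y).mp hy
  exact (hF V' y).mpr ⟨C, hC.trans h, hy⟩

/-- On a connected open `U` the extension `F` is `e` itself: `F(U) = e(U)`.
[cite: MochizukiFrdII2008, Thm A.2 (vi) p.68] -/
theorem ext_apply_open0 {F : Opens X → Opens Y}
    (hF : ∀ (V : Opens X) (y : Y), y ∈ F V ↔ ∃ C : Open0 X, C.obj ≤ V ∧ y ∈ (e.functor.obj C).obj)
    (U : Open0 X) : F U.obj = (e.functor.obj U).obj := by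
  ext y
  rw [SetLike.mem_coe, SetLike.mem_coe, hF]
  exact ⟨fun ⟨C, hC, hy⟩ => functor_obj_mono e hC hy, fun hy => ⟨U, le_rfl, hy⟩⟩

/-- Key step of Theorem A.2 (vi): a connected open `D ⊆ F(V)` of `Y` pulls back into `V`. Indeed
`F(V)` is the *disjoint* union of the images `e(Cᵢ)` of the connected components `Cᵢ` of `V`
(Theorem A.2 (v) and preservation of disjointness), so the connected `D` lies in a single `e(Cᵢ)` and
`e⁻¹(D) ⊆ Cᵢ ⊆ V`. [cite: MochizukiFrdII2008, Thm A.2 (vi) p.68] -/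
theorem inverse_obj_le_of_le_ext [LocallyConnectedSpace X] [LocallyConnectedSpace Y]
    {F : Opens X → Opens Y}
    (hF : ∀ (V : Opens X) (y : Y), y ∈ F V ↔ ∃ C : Open0 X, C.obj ≤ V ∧ y ∈ (e.functor.obj C).obj)
    {V : Opens X} {D : Open0 Y} (hD : D.obj ≤ F V) : (e.inverse.obj D).obj ≤ V := by
  obtain ⟨Fd, hFdV, hcomp⟩ := exists_disjt_union_eq V
  -- the image collection `{e(Cᵢ)}` is again a collection of disjoint objects
  have hinj : Injective fun i => e.functor.obj (Fd.obj.obj i) := by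
    intro i j hij
    exact Fd.property.1 (by simpa only [inverse_obj_functor_obj] using congrArg e.inverse.obj hij)
  have hpair := (isDisjointCollection_iff_pairwise_disjoint Fd.obj.obj Fd.property.1).mp Fd.property
  have hdisj : IsDisjointCollection fun i => e.functor.obj (Fd.obj.obj i) :=
    (isDisjointCollection_iff_pairwise_disjoint _ hinj).mpr fun i j hij =>
      disjoint_functor_obj e (hpair hij)
  let G : Disjt Y := ⟨⟨Fd.obj.I, fun i => e.functor.obj (Fd.obj.obj i)⟩, hdisj⟩
  -- `D ⊆ F(V) ⊆ ⋃ᵢ e(Cᵢ)`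
  have hDG : D.obj ≤ (union Y).obj G := by
    intro y hy
    obtain ⟨C, hCV, hyC⟩ := (hF V y).mp (hD hy)
    obtain ⟨x, hxC⟩ := C.property.nonempty
    have hxV : x ∈ (V : Set X) := hCV hxC
    obtain ⟨i, hi⟩ := (mem_union_obj_iff Fd x).mp (by rw [hFdV]; exact hxV)
    obtain ⟨xi, _, hFi⟩ := hcomp i
    have hCi : C.obj ≤ (Fd.obj.obj i).obj := by
      intro z hz
      change z ∈ (((Fd.obj.obj i).obj : Opens X) : Set X)
      rw [hFi, connectedComponentIn_eq (hFi ▸ hi : x ∈ connectedComponentIn (V : Set X) xi)]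
      exact C.property.isPreconnected.subset_connectedComponentIn hxC hCV hz
    exact (mem_union_obj_iff G y).mpr ⟨i, functor_obj_mono e hCi hyC⟩
  obtain ⟨j, hj⟩ := exists_le_of_le_union D G hDG
  calc (e.inverse.obj D).obj ≤ (e.inverse.obj (e.functor.obj (Fd.obj.obj j))).obj :=
        inverse_obj_mono e hj
    _ = (Fd.obj.obj j).obj := by rw [inverse_obj_functor_obj]
    _ ≤ (union X).obj Fd := le_iSup (fun i => (Fd.obj.obj i).obj) j
    _ = V := hFdV

/-- The extensions `F` of `e` and `G` of `e⁻¹` satisfy `G(F(V)) = V`.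
[cite: MochizukiFrdII2008, Thm A.2 (vi) p.68] -/
theorem ext_inverse_ext [LocallyConnectedSpace X] [LocallyConnectedSpace Y]
    {F : Opens X → Opens Y} {G : Opens Y → Opens X}
    (hF : ∀ (V : Opens X) (y : Y), y ∈ F V ↔ ∃ C : Open0 X, C.obj ≤ V ∧ y ∈ (e.functor.obj C).obj)
    (hG : ∀ (W : Opens Y) (x : X), x ∈ G W ↔ ∃ D : Open0 Y, D.obj ≤ W ∧ x ∈ (e.inverse.obj D).obj)
    (V : Opens X) : G (F V) = V := by
  ext x
  rw [SetLike.mem_coe, SetLike.mem_coe, hG]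
  constructor
  · rintro ⟨D, hD, hx⟩
    exact inverse_obj_le_of_le_ext e hF hD hx
  · intro hx
    let C : Open0 X := ⟨⟨connectedComponentIn (V : Set X) x, V.isOpen.connectedComponentIn⟩,
      isConnected_connectedComponentIn_iff.mpr hx⟩
    refine ⟨e.functor.obj C, ?_, ?_⟩
    · intro y hy
      exact (hF V y).mpr ⟨C, connectedComponentIn_subset _ _, hy⟩
    · rw [inverse_obj_functor_obj]
      exact mem_connectedComponentIn hx

end equivalence

variable (X Y) in
/-- **Theorem A.2 (vi)**, PROVED (FrdII App. pp. 67–68): "Suppose that `X`, `Y` are sober and locally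
connected. Then passing to the induced equivalence on the categories `Open⁰(−)` determines a bijection
between the equivalences of categories `Open⁰(X) ≃ Open⁰(Y)` [considered up to isomorphism] and the
homeomorphisms `X ≃ Y`": every equivalence `e` agrees on connected opens with `h.opensCongr` for a unique
homeomorphism `h`. Proof as printed: extend `e` to an order isomorphism of `Open(−)` through the
decomposition into connected components (Theorem A.2 (v)) and apply (iv).
[cite: MochizukiFrdII2008, Thm A.2 (vi) p.67] -/
theorem ItemVI_holds : ItemVI X Y := by
  intro hX hY hlX hlY e
  let F : Opens X → Opens Y := fun V => ⨆ (C : Open0 X) (_ : C.obj ≤ V), (e.functor.obj C).obj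
  let G : Opens Y → Opens X := fun W => ⨆ (D : Open0 Y) (_ : D.obj ≤ W), (e.inverse.obj D).obj
  have hF : ∀ (V : Opens X) (y : Y), y ∈ F V ↔
      ∃ C : Open0 X, C.obj ≤ V ∧ y ∈ (e.functor.obj C).obj := fun V y => by
    simp only [F, Opens.mem_iSup, exists_prop]
  have hG : ∀ (W : Opens Y) (x : X), x ∈ G W ↔
      ∃ D : Open0 Y, D.obj ≤ W ∧ x ∈ (e.inverse.obj D).obj := fun W x => by
    simp only [G, Opens.mem_iSup, exists_prop]
  have hGF : ∀ V, G (F V) = V := ext_inverse_ext e hF hG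
  have hFG : ∀ W, F (G W) = W := ext_inverse_ext e.symm hG hF
  let f : Opens X ≃o Opens Y :=
    { toFun := F, invFun := G, left_inv := hGF, right_inv := hFG,
      map_rel_iff' := fun {V V'} =>
        ⟨fun h => by
          have h' : F V ≤ F V' := h
          simpa only [hGF] using ext_mono e.symm hG h', ext_mono e hF⟩ }
  obtain ⟨h, hh, huniq⟩ := existsUnique_homeomorph_of_orderIso hX hY f
  refine ⟨h, fun U => ?_, fun h' hh' => huniq h' fun V => ?_⟩
  · rw [← hh U.obj]
    exact (ext_apply_open0 e hF U).symm
  · ext y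
    change y ∈ F V ↔ y ∈ h'.opensCongr V
    rw [hF, mem_opensCongr_iff]
    constructor
    · rintro ⟨C, hCV, hy⟩
      rw [hh' C, mem_opensCongr_iff] at hy
      exact hCV hy
    · intro hy
      refine ⟨⟨⟨connectedComponentIn (V : Set X) (h'.symm y), V.isOpen.connectedComponentIn⟩,
        isConnected_connectedComponentIn_iff.mpr hy⟩, connectedComponentIn_subset _ _, ?_⟩
      rw [hh', mem_opensCongr_iff]
      exact mem_connectedComponentIn hy

end TopRep

end Literature.AlgebraicGeometry.Frobenioids
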